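import Summits.CriticalPhenomena.PercolationContinuityZ3.Theorems.Transplant.SkelPhiRootChainF
import Summits.CriticalPhenomena.PercolationContinuityZ3.Theorems.Transplant.SkelPhiCorridorKGRouteW
import HarnessLib

/-!
# N2 (frames-only node `SamePDropOfSkeletonFrm₁`, OPEN), (R) column ((R-26)): **THE ROOT LEG ALONG THE FIRST AXIS OVER THE K-G CORRIDOR OF RECORD** —
# `Skelφ.rootChainF_of_kgCorr` = `rootChainF_of_sched` (SkelPhiRootChainF p345773) at `Sc := kgCorrSched hP₁ hP₂ hsplit` (SkelPhiParaCorridorKG) with the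
# per-step per-centre input `hrouteSW_kgCorr` (p5-g15, SkelPhiCorridorKGRouteW) from the long x-links and y′-links at every centre; the sub-box law on the region
# windows is the root-seed law's (`isSubbox_W0pin_win` from the seed clearance); the SEED is the zone at the root `Λc root kz` (`rootChainF_of_schedNZ`, p3-g16)
# and the chain LENGTH is exposed (`(kgCorrSched …).N`) so that the (R) wrapper serves the flat root table at the chain's own length.  The second axis
# (`kgCorrSchedY`, `hrouteSW_kgCorrY`) is the twin below.

builds on p205010 (kernel theorem, internal audit signed; external expert review pending) — nothing in this file uses p205010; nothing here is a
claim about the open node `SamePDropOfSkeletonFrm₁`.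
Lane `prim-bschramm`, seat `prim-bschramm-p3` (gen 15 typed / gen 16 filed; N2 design owner, (R) column owner); helper file (`--supports stmt-CriticalPhenomena-4575 --as helper`).
[cite: KozmaNitzan2024, §4 p. 28 ((32) at the root), Lemma 11 (pp. 22–23), Lemma 12 (pp. 23–25)] [cite: MartineauTassion2017, §4.3 Lemma 4.2]
-/


noncomputable section

open MeasureTheory ProbabilityTheory
open scoped ENNReal Classical

namespace Summit.CriticalPhenomena.PercolationContinuityZ3.Theorems

namespace Transplant

namespace Skelφ

open Literature.Probability.Percolation Literature.Probability.LatticeModels SimpleGraph GadgetSystem ProbeHistory HSiteScheme Contour KNCells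
open KNCells.KSchA KNLevels ChainPlanar ChainPara
open Literature.Barriers.CriticalPhenomena (graphBall graphBall_mono)
open Skel (winGraph)
open SkelI (tanOff)

variable {V : Type} [DecidableEq V] [Countable V] {G : SimpleGraph V} [G.LocallyFinite] {φ : V → Site 2}

/-- **THE ROOT LEG ALONG THE FIRST AXIS OVER THE K-G CORRIDOR OF RECORD**, `RootOblTWF` shape (hypotheses: `rootChainF_of_sched`'s with the corridor
fixed, the route input replaced by the long links at every centre, the seed := the zone at the root, the chain length exposed `= (kgCorrSched …).N`;
over `rootChainF_of_schedNZ`). [cite: KozmaNitzan2024, §4 p. 28 ((32) at the root), Lemma 12 (pp. 23–25)] -/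
theorem rootChainF_of_kgCorr
    -- the scheme, the direction
    {A : Type*} {S : KSchA V A} (du : MDir)
    -- the skeleton map, the frame
    (hlipφ : Lip G φ) (hstep : Steps G φ) {Δ : ℕ} (hΔ : ∀ v, G.degree v ≤ Δ) {types : Finset V} (hfr : Frames G φ types) (hκ : CylConn G φ types)
    {n ℓ : ℕ} {hs v : ℤ} (hn : 1 ≤ n) (c₀ : V) {σ : ℤ} (hσ : σ = 1 ∨ σ = -1) {kq : ℕ} (hκL : hs.natAbs ≤ kq * n)
    -- the K-G corridor of record (first axis), the window
    {R' ρ qq Wd N m₁ Wm₂ Wp₂ m₂ : ℕ}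
    (hP₁ : ParkOK (kgPark₁ n ℓ hs v R' ρ qq Wd N m₁)) (hP₂ : ParkOK (kgPark₂ n ℓ hs v R' ρ qq Wd N m₁ Wm₂ Wp₂ m₂))
    (hsplit : (Wm₂ : ℤ) + Wp₂ = (kgPark₁ n ℓ hs v R' ρ qq Wd N m₁).aHi (m₁ + 1) - ParkPrm.aLo (kgPark₁ n ℓ hs v R' ρ qq Wd N m₁) (m₁ + 1))
    {w₀ : V} {R r Rl : ℕ} (hr : Rl ≤ r) (hrR : r ≤ R)
    -- kit constants
    (Pk : ApronPrm) {Mz Rs KCmax rs cS cU : ℕ} (hPN : kq + 3 ≤ Pk.N) (hA : Pk.A = (Mz + 1 : ℕ) * (shearUnit n hs : ℤ) + 1)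
    (hdD : Pk.d + 2 ≤ shellD Pk) (hDρ : Rs + 1 ≤ shellD Pk) (hKCmax : (shellD Pk + Mz + 1) * (kq + 1) ≤ KCmax)
    (hT : (shellD Pk : ℤ) + KCmax + Rs ≤ tanOff Pk.ℓs Pk.M)
    (hr₀ : Pk.N * (tanOff Pk.ℓs Pk.M + 2) + Pk.N * Pk.d + (KCmax + Rs) ≤ Pk.r₀) (hR : Pk.r₀ ≤ R)
    (hrs : 1 + (Pk.N * (tanOff Pk.ℓs Pk.M + 2) + Pk.N * Pk.d + (KCmax + Rs)) ≤ rs)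
    (hcS : (Pk.N + 1) * (tanOff Pk.ℓs Pk.M + 1) + (Pk.N + 1) * Pk.d + (KCmax + 1) + cU ≤ cS)
    (hreach : r + (Pk.N * (tanOff Pk.ℓs Pk.M + 1) + Pk.N * Pk.d + KCmax) ≤ Pk.r₀)
    -- the short region and the zone datum
    (Rg : V → Finset V) (hRg : ∀ c, ∀ u ∈ Rg c, u ∈ graphBall G c Rs) (hRgcard : ∀ c, (Rg c).card ≤ cU) (hcU1 : 1 ≤ cU)
    (Λc : V → ℕ → Finset V) (kz : ℕ) (hΛRg : ∀ c, Λc c kz ⊆ Rg c) (hzconn : ∀ c, ∀ s ∈ Λc c kz, PathIn G (↑(Λc c kz) : Set V) c s)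
    (hcz : ∀ c, c ∈ Λc c kz) {Rk : ℕ} (hkz : 1 ≤ kz) (hRk : cylRadMax G φ types kz (2 * KCmax) ≤ Rk) (hΛcyl : ∀ c, cylBallFin G φ c kz Rk ⊆ Λc c kz)
    -- the chain data (world `U' := (Q₀ ∪ E_{0,du}) ∩ B(w₀, R)`)
    (Pd : WinChainData V) (hPo : Pd.o = S.Γ.root) (hPS : Pd.Sfin = (S.U0root du).filter fun y => y ∈ graphBall G w₀ R)
    (hj0 : tanOff Pk.ℓs Pk.M ≤ Pd.j₀) (hj : Pd.j₁ ≤ Pd.Rlev) (hRl : Pd.Rlev + 1 ≤ (kgCorrSched hP₁ hP₂ hsplit).R')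
    (hE : Pd.j₁ + (Pk.N * (tanOff Pk.ℓs Pk.M + 1) + Pk.N * Pk.d + KCmax) ≤ (kgCorrSched hP₁ hP₂ hsplit).R')
    {Δ' : ℕ} {δ η : ℝ} (hδ : 0 < δ) (hη : η ≤ δ / 2)
    (kk : ℕ) (hN : kk * (Δ + 1) ^ (2 * rs) ≤ Pd.N) (hk : (1 - (S.p : ℝ) ^ (1 + Δ * cS + cS * cU)) ^ kk ≤ δ)
    (hcount : 1 / (1 - (S.p : ℝ)) ^ (Δ' * Pd.N) ≤ δ * ((Finset.Icc Pd.j₀ Pd.j₁).card : ℝ))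
    -- THE SEED := THE ZONE AT THE ROOT `Λc root kz` inside the root cube and the window ball; the hop prism `Qp` in the world; the hop into the first core window
    (hZQ : Λc S.Γ.root kz ⊆ S.Γ.Q S.Γ.a₀ 0) (hZR : ∀ u ∈ Λc S.Γ.root kz, u ∈ graphBall G w₀ R)
    {Qp : Finset V} (hQU : Qp ⊆ (S.U0root du).filter fun y => y ∈ graphBall G w₀ R)
    (hlink : 1 - δ < (bondPercolation G S.p).real (linkIn (↑Qp : Set V) (Λc S.Γ.root kz) (Win G (runX φ c₀ n hs σ) w₀ (ScheduleNP.core (kgCorrSched hP₁ hP₂ hsplit) 0) R)))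
    -- the world rows (vertex form): every region window lies in `Q₀ ∪ E_{0,du}` and clears the seed; the rim; depth; the arrival cube
    (hreg : ∀ k ≤ (kgCorrSched hP₁ hP₂ hsplit).N, ∀ u ∈ graphBall G w₀ R, runX φ c₀ n hs σ u ∈ (kgCorrSched hP₁ hP₂ hsplit).region k → u ∈ S.U0root du)
    (hdis : ∀ k ≤ (kgCorrSched hP₁ hP₂ hsplit).N, Disjoint (Win G (runX φ c₀ n hs σ) w₀ ((kgCorrSched hP₁ hP₂ hsplit).region k) R) (Λc S.Γ.root kz))
    (hRim : ∀ k, Pd.Rim k ⊆ Win G (runX φ c₀ n hs σ) w₀ ((kgCorrSched hP₁ hP₂ hsplit).region k) R)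
    (hcover : ∀ k ≤ (kgCorrSched hP₁ hP₂ hsplit).N, ∀ v ∈ Win G (runX φ c₀ n hs σ) w₀ ((kgCorrSched hP₁ hP₂ hsplit).region k) R, v ∉ graphBall G w₀ (R - Pk.r₀) → v ∈ Pd.Rim k)
    (hTne : ∀ k ≤ (kgCorrSched hP₁ hP₂ hsplit).N, (Win G (runX φ c₀ n hs σ) w₀ (ScheduleNP.core (kgCorrSched hP₁ hP₂ hsplit) (k + 1)) R).Nonempty)
    (hlastM : ∀ u ∈ graphBall G w₀ R, runX φ c₀ n hs σ u ∈ ScheduleNP.core (kgCorrSched hP₁ hP₂ hsplit) ((kgCorrSched hP₁ hP₂ hsplit).N + 1) → u ∈ S.Γ.M S.Γ.a₀ ((0 : Site 2) + stepVec du))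
    (hexc : ∀ k ≤ (kgCorrSched hP₁ hP₂ hsplit).N,
      (prodBernoulli (S.W0pin G (edgesIn G (Λc S.Γ.root kz)) ((S.U0root du).filter fun y => y ∈ graphBall G w₀ R))).real (⋃ t' ∈ Pd.Rim k, openConn S.Γ.root t') ≤ η)
    -- THE LONG LINKS AT EVERY CENTRE at accuracy `δ³` under `P_p` (the (S0) Step-I‴ inputs; the route input is p5-g15's `hrouteSW_kgCorr`)
    (hlong : ∀ c (τ : ℤ), τ = 1 ∨ τ = -1 → 1 - δ ^ 3 < (bondPercolation G S.p).real
      (linkIn (pgramPrism G φ c n hs (3 * ℓ) Rl) (Λc c kz) (pgSideHalfW G φ c n hs ℓ Rl σ (σ * τ))))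
    (hlongY : ∀ c (τ : ℤ), τ = 1 ∨ τ = -1 → 1 - δ ^ 3 < (bondPercolation G S.p).real
      (linkIn (pgramPrism G φ c n hs (3 * ℓ) Rl) (Λc c kz) (pgTopPieceW G φ c n hs ℓ Rl σ τ v))) :
    ∃ (c : V) (Rπ : ℕ) (W : Sym2 V → unitInterval) (s : Fin ((kgCorrSched hP₁ hP₂ hsplit).N + 1) → KNLevels.TStep (winGraph G c Rπ))
      (T' : Fin ((kgCorrSched hP₁ hP₂ hsplit).N + 1) → Finset V) (η' : ℝ),
      (∀ T : Finset V, (prodBernoulli W).real (⋃ t ∈ T, openConn S.Γ.root t) ≤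
        (prodBernoulli (pinW (KNLevels.lattW G S.p) ↑(S.U₀ G) ↑(S.U₀ G))).real
          (⋃ t ∈ (↑T : Set V), openConnIn (↑(S.Γ.Q S.Γ.a₀ 0 ∪ S.Γ.Ewv S.Γ.a₀ 0 du) : Set V) S.Γ.root t)) ∧
      (∀ i : Fin ((kgCorrSched hP₁ hP₂ hsplit).N + 1), (s i).L.o = S.Γ.root) ∧
      (∀ i : Fin (kgCorrSched hP₁ hP₂ hsplit).N, T' (Fin.castSucc i) ⊆ (s i.succ).L.X 0) ∧ (∀ i : Fin ((kgCorrSched hP₁ hP₂ hsplit).N + 1), T' i ⊆ (s i).T) ∧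
      (∀ i : Fin ((kgCorrSched hP₁ hP₂ hsplit).N + 1), (s i).KitsAtF W S.p Δ' δ) ∧ η' ≤ δ / 2 ∧
      (∀ i : Fin ((kgCorrSched hP₁ hP₂ hsplit).N + 1), (prodBernoulli W).real (⋃ t ∈ (s i).T \ T' i, openConn S.Γ.root t) ≤ η') ∧
      1 - δ < (prodBernoulli W).real (s 0).L.reachB ∧
      T' (Fin.last (kgCorrSched hP₁ hP₂ hsplit).N) ⊆ S.Γ.M S.Γ.a₀ ((0 : Site 2) + stepVec du) := by
  -- the region windows lie in the world and clear the seed, so the root-seed law is a subbox law there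
  have hWD : ∀ k ≤ (kgCorrSched hP₁ hP₂ hsplit).N, IsSubbox (winGraph G w₀ R)
      (S.W0pin G (edgesIn G (Λc S.Γ.root kz)) ((S.U0root du).filter fun y => y ∈ graphBall G w₀ R)) S.p
      (Win G (runX φ c₀ n hs σ) w₀ ((kgCorrSched hP₁ hP₂ hsplit).region k) R) := by
    intro k hk
    refine Skel.isSubbox_W0pin_win (S := S) w₀ R (fun u hu => ?_) (fresh_of_disjoint (fun e he w hw => (mem_edgesIn_iff.1 he).2 w hw) (hdis k hk))
    obtain ⟨hub, huR⟩ := (mem_Win (G := G) (φ := runX φ c₀ n hs σ)).1 hu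
    exact Finset.mem_filter.2 ⟨hreg k hk u hub huR, hub⟩
  exact rootChainF_of_schedNZ du hlipφ hstep hΔ hfr hκ hn c₀ hσ hκL (kgCorrSched hP₁ hP₂ hsplit) Pk hPN hA hdD hDρ hKCmax hT hr₀ hR hrs hcS
    hreach Rg hRg hRgcard hcU1 Λc kz hΛRg hzconn hcz hkz hRk hΛcyl Pd hPo hPS hj0 hj hRl hE hδ hη kk hN hk hcount hZQ hZR hQU hlink
    hreg hdis hRim hcover hTne hlastM hexc
    (hrouteSW_kgCorr hP₁ hP₂ hsplit hn c₀ hσ hr hrR Pd.Rim hWD Λc kz hlong hlongY)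

/-- **THE ROOT LEG ALONG THE SECOND AXIS OVER THE K-G CORRIDOR OF RECORD** (`kgCorrSchedY`, `hrouteSW_kgCorrY`): the twin of
`rootChainF_of_kgCorr` (extra frame rows `hv : |v| ≤ n`, `hlay`). [cite: KozmaNitzan2024, §4 p. 28 ((32) at the root), Lemma 12 (pp. 23–25)] -/
theorem rootChainF_of_kgCorrY
    -- the scheme, the direction
    {A : Type*} {S : KSchA V A} (du : MDir)
    -- the skeleton map, the frame
    (hlipφ : Lip G φ) (hstep : Steps G φ) {Δ : ℕ} (hΔ : ∀ v, G.degree v ≤ Δ) {types : Finset V} (hfr : Frames G φ types) (hκ : CylConn G φ types)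
    {n ℓ : ℕ} {hs v : ℤ} (hn : 1 ≤ n) (hv : |v| ≤ n) (hlay : (n + hs.natAbs : ℕ) ≤ (n : ℤ) * ℓ + 1) (c₀ : V) {σ : ℤ} (hσ : σ = 1 ∨ σ = -1) {kq : ℕ} (hκL : hs.natAbs ≤ kq * n)
    -- the K-G corridor of record (second axis), the window
    {R' ρ qq Wd N m₁ Wm₂ Wp₂ m₂ : ℕ}
    (hP₁ : ParkOK (kgPark₁Y n ℓ hs v R' ρ qq Wd N m₁)) (hP₂ : ParkOK (kgPark₂Y n ℓ hs v R' ρ qq Wd N m₁ Wm₂ Wp₂ m₂))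
    (hsplit : (Wm₂ : ℤ) + Wp₂ = (kgPark₁Y n ℓ hs v R' ρ qq Wd N m₁).aHi (m₁ + 1) - ParkPrm.aLo (kgPark₁Y n ℓ hs v R' ρ qq Wd N m₁) (m₁ + 1))
    {w₀ : V} {R r Rl : ℕ} (hr : Rl ≤ r) (hrR : r ≤ R)
    -- kit constants
    (Pk : ApronPrm) {Mz Rs KCmax rs cS cU : ℕ} (hPN : kq + 3 ≤ Pk.N) (hA : Pk.A = (Mz + 1 : ℕ) * (shearUnit n hs : ℤ) + 1)
    (hdD : Pk.d + 2 ≤ shellD Pk) (hDρ : Rs + 1 ≤ shellD Pk) (hKCmax : (shellD Pk + Mz + 1) * (kq + 1) ≤ KCmax)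
    (hT : (shellD Pk : ℤ) + KCmax + Rs ≤ tanOff Pk.ℓs Pk.M)
    (hr₀ : Pk.N * (tanOff Pk.ℓs Pk.M + 2) + Pk.N * Pk.d + (KCmax + Rs) ≤ Pk.r₀) (hR : Pk.r₀ ≤ R)
    (hrs : 1 + (Pk.N * (tanOff Pk.ℓs Pk.M + 2) + Pk.N * Pk.d + (KCmax + Rs)) ≤ rs)
    (hcS : (Pk.N + 1) * (tanOff Pk.ℓs Pk.M + 1) + (Pk.N + 1) * Pk.d + (KCmax + 1) + cU ≤ cS)
    (hreach : r + (Pk.N * (tanOff Pk.ℓs Pk.M + 1) + Pk.N * Pk.d + KCmax) ≤ Pk.r₀)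
    -- the short region and the zone datum
    (Rg : V → Finset V) (hRg : ∀ c, ∀ u ∈ Rg c, u ∈ graphBall G c Rs) (hRgcard : ∀ c, (Rg c).card ≤ cU) (hcU1 : 1 ≤ cU)
    (Λc : V → ℕ → Finset V) (kz : ℕ) (hΛRg : ∀ c, Λc c kz ⊆ Rg c) (hzconn : ∀ c, ∀ s ∈ Λc c kz, PathIn G (↑(Λc c kz) : Set V) c s)
    (hcz : ∀ c, c ∈ Λc c kz) {Rk : ℕ} (hkz : 1 ≤ kz) (hRk : cylRadMax G φ types kz (2 * KCmax) ≤ Rk) (hΛcyl : ∀ c, cylBallFin G φ c kz Rk ⊆ Λc c kz)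
    -- the chain data (world `U' := (Q₀ ∪ E_{0,du}) ∩ B(w₀, R)`)
    (Pd : WinChainData V) (hPo : Pd.o = S.Γ.root) (hPS : Pd.Sfin = (S.U0root du).filter fun y => y ∈ graphBall G w₀ R)
    (hj0 : tanOff Pk.ℓs Pk.M ≤ Pd.j₀) (hj : Pd.j₁ ≤ Pd.Rlev) (hRl : Pd.Rlev + 1 ≤ (kgCorrSchedY hn hv hlay hP₁ hP₂ hsplit).R')
    (hE : Pd.j₁ + (Pk.N * (tanOff Pk.ℓs Pk.M + 1) + Pk.N * Pk.d + KCmax) ≤ (kgCorrSchedY hn hv hlay hP₁ hP₂ hsplit).R')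
    {Δ' : ℕ} {δ η : ℝ} (hδ : 0 < δ) (hη : η ≤ δ / 2)
    (kk : ℕ) (hN : kk * (Δ + 1) ^ (2 * rs) ≤ Pd.N) (hk : (1 - (S.p : ℝ) ^ (1 + Δ * cS + cS * cU)) ^ kk ≤ δ)
    (hcount : 1 / (1 - (S.p : ℝ)) ^ (Δ' * Pd.N) ≤ δ * ((Finset.Icc Pd.j₀ Pd.j₁).card : ℝ))
    -- THE SEED := THE ZONE AT THE ROOT `Λc root kz` inside the root cube and the window ball; the hop prism `Qp` in the world; the hop into the first core window
    (hZQ : Λc S.Γ.root kz ⊆ S.Γ.Q S.Γ.a₀ 0) (hZR : ∀ u ∈ Λc S.Γ.root kz, u ∈ graphBall G w₀ R)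
    {Qp : Finset V} (hQU : Qp ⊆ (S.U0root du).filter fun y => y ∈ graphBall G w₀ R)
    (hlink : 1 - δ < (bondPercolation G S.p).real (linkIn (↑Qp : Set V) (Λc S.Γ.root kz) (Win G (runX φ c₀ n hs σ) w₀ (ScheduleNP.core (kgCorrSchedY hn hv hlay hP₁ hP₂ hsplit) 0) R)))
    -- the world rows (vertex form): every region window lies in `Q₀ ∪ E_{0,du}` and clears the seed; the rim; depth; the arrival cube
    (hreg : ∀ k ≤ (kgCorrSchedY hn hv hlay hP₁ hP₂ hsplit).N, ∀ u ∈ graphBall G w₀ R, runX φ c₀ n hs σ u ∈ (kgCorrSchedY hn hv hlay hP₁ hP₂ hsplit).region k → u ∈ S.U0root du)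
    (hdis : ∀ k ≤ (kgCorrSchedY hn hv hlay hP₁ hP₂ hsplit).N, Disjoint (Win G (runX φ c₀ n hs σ) w₀ ((kgCorrSchedY hn hv hlay hP₁ hP₂ hsplit).region k) R) (Λc S.Γ.root kz))
    (hRim : ∀ k, Pd.Rim k ⊆ Win G (runX φ c₀ n hs σ) w₀ ((kgCorrSchedY hn hv hlay hP₁ hP₂ hsplit).region k) R)
    (hcover : ∀ k ≤ (kgCorrSchedY hn hv hlay hP₁ hP₂ hsplit).N, ∀ v ∈ Win G (runX φ c₀ n hs σ) w₀ ((kgCorrSchedY hn hv hlay hP₁ hP₂ hsplit).region k) R, v ∉ graphBall G w₀ (R - Pk.r₀) → v ∈ Pd.Rim k)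
    (hTne : ∀ k ≤ (kgCorrSchedY hn hv hlay hP₁ hP₂ hsplit).N, (Win G (runX φ c₀ n hs σ) w₀ (ScheduleNP.core (kgCorrSchedY hn hv hlay hP₁ hP₂ hsplit) (k + 1)) R).Nonempty)
    (hlastM : ∀ u ∈ graphBall G w₀ R, runX φ c₀ n hs σ u ∈ ScheduleNP.core (kgCorrSchedY hn hv hlay hP₁ hP₂ hsplit) ((kgCorrSchedY hn hv hlay hP₁ hP₂ hsplit).N + 1) → u ∈ S.Γ.M S.Γ.a₀ ((0 : Site 2) + stepVec du))
    (hexc : ∀ k ≤ (kgCorrSchedY hn hv hlay hP₁ hP₂ hsplit).N,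
      (prodBernoulli (S.W0pin G (edgesIn G (Λc S.Γ.root kz)) ((S.U0root du).filter fun y => y ∈ graphBall G w₀ R))).real (⋃ t' ∈ Pd.Rim k, openConn S.Γ.root t') ≤ η)
    -- THE LONG LINKS AT EVERY CENTRE at accuracy `δ³` under `P_p` (the (S0) Step-I‴ inputs; the route input is p5-g15's `hrouteSW_kgCorr`)
    (hlong : ∀ c (τ : ℤ), τ = 1 ∨ τ = -1 → 1 - δ ^ 3 < (bondPercolation G S.p).real
      (linkIn (pgramPrism G φ c n hs (3 * ℓ) Rl) (Λc c kz) (pgSideHalfW G φ c n hs ℓ Rl σ (σ * τ))))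
    (hlongY : ∀ c (τ : ℤ), τ = 1 ∨ τ = -1 → 1 - δ ^ 3 < (bondPercolation G S.p).real
      (linkIn (pgramPrism G φ c n hs (3 * ℓ) Rl) (Λc c kz) (pgTopPieceW G φ c n hs ℓ Rl σ τ v))) :
    ∃ (c : V) (Rπ : ℕ) (W : Sym2 V → unitInterval) (s : Fin ((kgCorrSchedY hn hv hlay hP₁ hP₂ hsplit).N + 1) → KNLevels.TStep (winGraph G c Rπ))
      (T' : Fin ((kgCorrSchedY hn hv hlay hP₁ hP₂ hsplit).N + 1) → Finset V) (η' : ℝ),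
      (∀ T : Finset V, (prodBernoulli W).real (⋃ t ∈ T, openConn S.Γ.root t) ≤
        (prodBernoulli (pinW (KNLevels.lattW G S.p) ↑(S.U₀ G) ↑(S.U₀ G))).real
          (⋃ t ∈ (↑T : Set V), openConnIn (↑(S.Γ.Q S.Γ.a₀ 0 ∪ S.Γ.Ewv S.Γ.a₀ 0 du) : Set V) S.Γ.root t)) ∧
      (∀ i : Fin ((kgCorrSchedY hn hv hlay hP₁ hP₂ hsplit).N + 1), (s i).L.o = S.Γ.root) ∧
      (∀ i : Fin (kgCorrSchedY hn hv hlay hP₁ hP₂ hsplit).N, T' (Fin.castSucc i) ⊆ (s i.succ).L.X 0) ∧ (∀ i : Fin ((kgCorrSchedY hn hv hlay hP₁ hP₂ hsplit).N + 1), T' i ⊆ (s i).T) ∧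
      (∀ i : Fin ((kgCorrSchedY hn hv hlay hP₁ hP₂ hsplit).N + 1), (s i).KitsAtF W S.p Δ' δ) ∧ η' ≤ δ / 2 ∧
      (∀ i : Fin ((kgCorrSchedY hn hv hlay hP₁ hP₂ hsplit).N + 1), (prodBernoulli W).real (⋃ t ∈ (s i).T \ T' i, openConn S.Γ.root t) ≤ η') ∧
      1 - δ < (prodBernoulli W).real (s 0).L.reachB ∧
      T' (Fin.last (kgCorrSchedY hn hv hlay hP₁ hP₂ hsplit).N) ⊆ S.Γ.M S.Γ.a₀ ((0 : Site 2) + stepVec du) := by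
  -- the region windows lie in the world and clear the seed, so the root-seed law is a subbox law there
  have hWD : ∀ k ≤ (kgCorrSchedY hn hv hlay hP₁ hP₂ hsplit).N, IsSubbox (winGraph G w₀ R)
      (S.W0pin G (edgesIn G (Λc S.Γ.root kz)) ((S.U0root du).filter fun y => y ∈ graphBall G w₀ R)) S.p
      (Win G (runX φ c₀ n hs σ) w₀ ((kgCorrSchedY hn hv hlay hP₁ hP₂ hsplit).region k) R) := by
    intro k hk
    refine Skel.isSubbox_W0pin_win (S := S) w₀ R (fun u hu => ?_) (fresh_of_disjoint (fun e he w hw => (mem_edgesIn_iff.1 he).2 w hw) (hdis k hk))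
    obtain ⟨hub, huR⟩ := (mem_Win (G := G) (φ := runX φ c₀ n hs σ)).1 hu
    exact Finset.mem_filter.2 ⟨hreg k hk u hub huR, hub⟩
  exact rootChainF_of_schedNZ du hlipφ hstep hΔ hfr hκ hn c₀ hσ hκL (kgCorrSchedY hn hv hlay hP₁ hP₂ hsplit) Pk hPN hA hdD hDρ hKCmax hT hr₀ hR hrs hcS
    hreach Rg hRg hRgcard hcU1 Λc kz hΛRg hzconn hcz hkz hRk hΛcyl Pd hPo hPS hj0 hj hRl hE hδ hη kk hN hk hcount hZQ hZR hQU hlink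
    hreg hdis hRim hcover hTne hlastM hexc
    (hrouteSW_kgCorrY hn hv hlay hP₁ hP₂ hsplit c₀ hσ hr hrR Pd.Rim hWD Λc kz hlong hlongY)

end Skelφ

end Transplant

end Summit.CriticalPhenomena.PercolationContinuityZ3.Theorems

end
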